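import Summits.Ventures.PercRepro.ProfilePointedCircuitClassesStarSharpD0V

/-!
# PercRepro — CASE D0 OF `StarNineSharp`, PART X: THREE `ef`-PLANE DEMANDS MAKE EVERY TRACE POINT A C-POINT
(p5, gen 55; `proofs/P5-GM1.md` §82 (c))

`cpoint_of_three_demands`: if all three pairs of the trace `T = {x, y, z}` of the ON plane `H` through `e, f` are
`ef`-plane demands (`ρ(π + e) = 3`, `(X − π) + f` a basis, R0 failing), then the opposite vertex `z` of `{x, y}` is a
C-point: `ρ{e, f, z} = 3` and `ρ(X − z) = 4` (and so are `x` and `y`, by symmetry of the hypotheses).  Pure rank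
arithmetic — no genericity of `b` is needed:
* `z` on the line `ef` would force `ρ(π + f) = 2` for `π = {x, y}` (R0 fails only so), then `ρ(π′ + f) = 3` for the
  other two demands, hence `ρ((X − π′) + e) ≤ 3` for both, and the two planes `{x, w, w′} + e`, `{y, w, w′} + e` meet in
  `{w, w′} + e` of rank `≤ 2`: `e ∈ cl{w, w′}`, against `ρ((X − π) + e) = 4`;
* `X − z` a plane would force `ρ(π + f) = 3`, so `ρ({z, w, w′} + e) = 3`, and one of the other demands has
  `ρ(π′ + f) = 3` (both on the line `fz` is impossible), hence `ρ((X − π′) + e) ≤ 3`: again two planes through `e`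
  meeting in `{w, w′} + e`, so `e ∈ cl{w, w′} ⊆ cl(X − z)`, against `ρ((X − z) + e) = 4`.
-/

open scoped Matroid

namespace PercRepro.Cogirth

open Finset ThmH Skew Shadow Profile

open Classical

variable {α : Type} [DecidableEq α] {N : Matroid α} [N.Finite]

section StarSharpD0X

variable {b b' : α}

/-- Two sets of rank `≤ 3` whose union contains a rank-4 set meet in rank `≤ 2` (submodularity). -/
theorem rk_le_two_of_two_planes {S₁ S₂ I U : Finset α} (hI : I ⊆ S₁ ∩ S₂) (hU : U ⊆ S₁ ∪ S₂)
    (hU4 : rk N U = 4) (h₁ : rk N S₁ ≤ 3) (h₂ : rk N S₂ ≤ 3) : rk N I ≤ 2 := by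
  have h1 := rk_union_add_rk_le_of_subset_inter' (N := N) hI
  have h2 : rk N U ≤ rk N (S₁ ∪ S₂) := rk_mono' hU
  omega

/-- `insert z {f, x} = insert f {x, z}`. -/
theorem insert_pair_eq_last' (f x z : α) : insert z ({f, x} : Finset α) = insert f {x, z} := by
  ext a; simp only [mem_insert, mem_singleton]; tauto

/-- `insert x {f, z} = insert f {x, z}`. -/
theorem insert_pair_comm3 (f x z : α) : insert x ({f, z} : Finset α) = insert f {x, z} := by
  ext a; simp only [mem_insert, mem_singleton]; tauto

/-- `{f, q} ⊆ insert f {p, q}`. -/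
theorem pair_subset_insert_pair' (f p q : α) : ({f, q} : Finset α) ⊆ insert f {p, q} := by
  intro a ha; simp only [mem_insert, mem_singleton] at ha ⊢; tauto

/-- `insert f {x, y} ⊆ insert y (insert x {f, z})`. -/
theorem insert_pair_subset_insert_insert' (f x y z : α) :
    insert f ({x, y} : Finset α) ⊆ insert y (insert x {f, z}) := by
  intro a ha; simp only [mem_insert, mem_singleton] at ha ⊢; tauto

/-- `{x, w, w'} ⊆ {x, y, w, w'}`. -/
theorem triple_subset_quad_skip (x y w w' : α) : ({x, w, w'} : Finset α) ⊆ {x, y, w, w'} := by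
  intro a ha; simp only [mem_insert, mem_singleton] at ha ⊢; tauto

/-- `insert w (insert e {p, q}) ⊆ insert e {p, w, w'} ∪ insert e {q, w, w'}`. -/
theorem insert_insert_pair_subset_union (e p q w w' : α) :
    insert w (insert e ({p, q} : Finset α)) ⊆ insert e {p, w, w'} ∪ insert e {q, w, w'} := by
  intro a ha; simp only [mem_insert, mem_singleton, mem_union] at ha ⊢; tauto

/-- `insert e {w, w'} ⊆ insert e {p, w, w'} ∩ insert e {q, w, w'}`. -/
theorem insert_pair_subset_inter (e p q w w' : α) :
    insert e ({w, w'} : Finset α) ⊆ insert e {p, w, w'} ∩ insert e {q, w, w'} := by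
  intro a ha; simp only [mem_insert, mem_singleton, mem_inter] at ha ⊢; tauto

/-- `insert w (insert e {p, q}) ⊆ insert e {p, q, w, w'}`. -/
theorem insert_insert_pair_subset_insert_quad (e p q w w' : α) :
    insert w (insert e ({p, q} : Finset α)) ⊆ insert e {p, q, w, w'} := by
  intro a ha; simp only [mem_insert, mem_singleton] at ha ⊢; tauto

/-- `{w, w'} ⊆ {p, q, w, w'}`. -/
theorem pair_subset_quad_last (p q w w' : α) : ({w, w'} : Finset α) ⊆ {p, q, w, w'} :=
  (subset_insert _ _).trans (subset_insert _ _)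

/-- **`e ∈ cl{w, w′}` IS IMPOSSIBLE WHEN `(X − π) + e` HAS RANK 4**: two planes `{x, w, w′} + e`, `{y, w, w′} + e`
(rank `≤ 3`) whose union contains the rank-4 set `{x, y, e, w}` meet in `{w, w′} + e` of rank `≤ 2`, so `e ∈ cl{w, w′}`
and `ρ({z, w, w′} + e) = ρ{z, w, w′} ≤ 3`. -/
theorem not_e_in_cl_W {e x y z w w' : α} (hxyw4 : rk N (insert w (insert e {x, y})) = 4) (hW2 : 2 ≤ rk N {w, w'})
    (hex : rk N (insert e {x, w, w'}) ≤ 3) (hey : rk N (insert e {y, w, w'}) ≤ 3)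
    (hez : rk N (insert e {z, w, w'}) = 4) : False := by
  have h1 := rk_le_two_of_two_planes (N := N) (insert_pair_subset_inter e x y w w')
    (insert_insert_pair_subset_union e x y w w') hxyw4 hex hey
  have h2 : rk N ({w, w'} : Finset α) ≤ rk N (insert e ({w, w'} : Finset α)) := rk_mono' (subset_insert _ _)
  have hew : rk N (insert e ({w, w'} : Finset α)) = rk N ({w, w'} : Finset α) := by omega
  have h3 := rk_insert_eq_of_rk_insert_eq_subset' (N := N) (S := ({w, w'} : Finset α)) (S' := ({z, w, w'} : Finset α))
    (w := e) (subset_insert _ _) hew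
  have h4 := rk_le_card' (M := N) ({z, w, w'} : Finset α)
  have h5 : ({z, w, w'} : Finset α).card ≤ 3 := by
    calc ({z, w, w'} : Finset α).card ≤ ({w, w'} : Finset α).card + 1 := card_insert_le _ _
      _ ≤ ({w'} : Finset α).card + 1 + 1 := by gcongr; exact card_insert_le _ _
      _ = 3 := by rw [card_singleton]
  omega

/-- **`X − z` IS NOT A PLANE WHEN TWO PLANES THROUGH `e` MEET IN `{w, w′} + e`**: with `ρ({p, z, e, w}) = 4`,
`ρ({p, w, w′} + e) ≤ 3` and `ρ({z, w, w′} + e) ≤ 3` give `e ∈ cl{w, w′} ⊆ cl{p, q, w, w′}`, so `{p, q, w, w′}` of rank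
`≤ 3` would absorb `e`, against `ρ({p, q, e, w}) = 4`. -/
theorem not_plane_of_two_e_planes {e p q z w w' : α} (hpqw4 : rk N (insert w (insert e {p, q})) = 4)
    (hpzw4 : rk N (insert w (insert e {p, z})) = 4) (hP3 : rk N {p, q, w, w'} ≤ 3) (hW2 : 2 ≤ rk N {w, w'})
    (hep : rk N (insert e {p, w, w'}) ≤ 3) (hez : rk N (insert e {z, w, w'}) ≤ 3) : False := by
  have h1 := rk_le_two_of_two_planes (N := N) (insert_pair_subset_inter e p z w w')
    (insert_insert_pair_subset_union e p z w w') hpzw4 hep hez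
  have h2 : rk N ({w, w'} : Finset α) ≤ rk N (insert e ({w, w'} : Finset α)) := rk_mono' (subset_insert _ _)
  have hew : rk N (insert e ({w, w'} : Finset α)) = rk N ({w, w'} : Finset α) := by omega
  have h3 := rk_insert_eq_of_rk_insert_eq_subset' (N := N) (S := ({w, w'} : Finset α))
    (S' := ({p, q, w, w'} : Finset α)) (w := e) (pair_subset_quad_last p q w w') hew
  have h4 : rk N (insert w (insert e ({p, q} : Finset α))) ≤ rk N (insert e ({p, q, w, w'} : Finset α)) :=
    rk_mono' (insert_insert_pair_subset_insert_quad e p q w w')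
  omega


/-- `{y, x, w, w'} = {x, y, w, w'}`. -/
theorem quad_swap12 (x y w w' : α) : ({y, x, w, w'} : Finset α) = {x, y, w, w'} := by
  ext a; simp only [mem_insert, mem_singleton]; tauto

/-- **THREE `ef`-PLANE DEMANDS MAKE THE OPPOSITE VERTEX A C-POINT**: if all three pairs of the trace `{x, y, z}` are
`ef`-plane demands, then `ρ{e, f, z} = 3` and `ρ{x, y, w, w′} = 4` (no genericity of `b` is used). -/
theorem cpoint_of_three_demands {e f : α} (he : e ∈ gr N) (hf : f ∈ gr N) (hef : e ≠ f)
    (he1 : ∀ y ∈ ((((gr N).erase b).erase b').erase f).erase e, rk N {e, y} = 2)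
    (hf1 : ∀ y ∈ ((((gr N).erase b).erase b').erase f).erase e, rk N {f, y} = 2)
    (hef2 : rk N {e, f} = 2)
    {H : Finset α} (hH : H ⊆ ((gr N).erase b).erase b') (heH : e ∈ H) (hH3 : rk N H = 3)
    (hHfl : ∀ z ∈ ((gr N).erase b).erase b', z ∉ H → rk N (insert z H) = 4)
    {x y z w w' : α}
    (hx : x ∈ ((((gr N).erase b).erase b').erase f).erase e) (hy : y ∈ ((((gr N).erase b).erase b').erase f).erase e)
    (hz : z ∈ ((((gr N).erase b).erase b').erase f).erase e) (hw : w ∈ ((((gr N).erase b).erase b').erase f).erase e)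
    (hw' : w' ∈ ((((gr N).erase b).erase b').erase f).erase e)
    (hxH : x ∈ H) (hyH : y ∈ H) (hzH : z ∈ H) (hwH : w ∉ H)
    (hYxy : rk N (insert e {x, y}) = 3) (hYcxy : rk N (insert f {z, w, w'}) = 4)
    (hR0xy : ¬ (rk N (insert f {x, y}) = 3 ∧ rk N (insert e {z, w, w'}) = 4))
    (hYxz : rk N (insert e {x, z}) = 3)
    (hR0xz : ¬ (rk N (insert f {x, z}) = 3 ∧ rk N (insert e {y, w, w'}) = 4))
    (hYyz : rk N (insert e {y, z}) = 3) (hYcyz : rk N (insert f {x, w, w'}) = 4)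
    (hR0yz : ¬ (rk N (insert f {y, z}) = 3 ∧ rk N (insert e {x, w, w'}) = 4)) :
    rk N {e, f, z} = 3 ∧ rk N {x, y, w, w'} = 4 := by
  have hXE : ((((gr N).erase b).erase b').erase f).erase e ⊆ ((gr N).erase b).erase b' :=
    (erase_subset _ _).trans (erase_subset _ _)
  have hE7g : ((gr N).erase b).erase b' ⊆ gr N := (erase_subset _ _).trans (erase_subset _ _)
  have hwE := hXE hw
  have hxg := hE7g (hXE hx)
  have hyg := hE7g (hXE hy)
  have hzg := hE7g (hXE hz)
  have hwg := hE7g hwE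
  have hw'g := hE7g (hXE hw')
  have hze : z ≠ e := (mem_erase.1 hz).1
  have hzf : z ≠ f := (mem_erase.1 (mem_erase.1 hz).2).1
  have hsub2 : ∀ p q : α, p ∈ gr N → q ∈ gr N → ({p, q} : Finset α) ⊆ gr N := by
    intro p q hp hq a ha; simp only [mem_insert, mem_singleton] at ha; rcases ha with rfl | rfl <;> assumption
  have hsub3 : ∀ p q r : α, p ∈ gr N → q ∈ gr N → r ∈ gr N → ({p, q, r} : Finset α) ⊆ gr N := by
    intro p q r hp hq hr a ha; simp only [mem_insert, mem_singleton] at ha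
    rcases ha with rfl | rfl | rfl <;> assumption
  have hcard2 : ∀ p q : α, ({p, q} : Finset α).card ≤ 2 := by
    intro p q
    calc ({p, q} : Finset α).card ≤ ({q} : Finset α).card + 1 := card_insert_le _ _
      _ = 2 := by rw [card_singleton]
  have hcard3 : ∀ p q r : α, ({p, q, r} : Finset α).card ≤ 3 := by
    intro p q r
    calc ({p, q, r} : Finset α).card ≤ ({q, r} : Finset α).card + 1 := card_insert_le _ _
      _ ≤ 3 := by have := hcard2 q r; omega
  have hcard4 : ∀ p q r s : α, ({p, q, r, s} : Finset α).card ≤ 4 := by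
    intro p q r s
    calc ({p, q, r, s} : Finset α).card ≤ ({q, r, s} : Finset α).card + 1 := card_insert_le _ _
      _ ≤ 4 := by have := hcard3 q r s; omega
  -- a pair of a rank-3 triple `insert e {p, q}` has rank 2
  have hpair2 : ∀ p q : α, p ∈ gr N → q ∈ gr N → rk N (insert e {p, q}) = 3 → rk N {p, q} = 2 := by
    intro p q hp hq h3
    have h1 := rk_insert_le_add_one (N := N) he (hsub2 p q hp hq)
    have h2 := rk_le_card' (M := N) ({p, q} : Finset α)
    have h4 := hcard2 p q
    omega
  have hxy2 := hpair2 x y hxg hyg hYxy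
  have hxz2 := hpair2 x z hxg hzg hYxz
  have hyz2 := hpair2 y z hyg hzg hYyz
  -- `ρ{w, w′} ≥ 2` (from `ρ({z, w, w′} + f) = 4`)
  have hW2 : 2 ≤ rk N ({w, w'} : Finset α) := by
    have h1 := rk_insert_le_add_one (N := N) hf (hsub3 z w w' hzg hwg hw'g)
    have h2 := rk_insert_le_add_one (N := N) hzg (hsub2 w w' hwg hw'g)
    rw [hYcxy] at h1
    omega
  -- the flat lemma: `ρ({p, q, e} + w) = 4` for a rank-3 set `{p, q, e} ⊆ H`
  have hflat : ∀ p q : α, p ∈ H → q ∈ H → rk N (insert e {p, q}) = 3 →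
      rk N (insert w (insert e {p, q})) = 4 := by
    intro p q hp hq h3
    have hsH : insert e ({p, q} : Finset α) ⊆ H := by
      intro a ha; simp only [mem_insert, mem_singleton] at ha
      rcases ha with rfl | rfl | rfl <;> assumption
    rw [rk_insert_eq_add_one_of_subset_flat (N := N) (H := H) (S := insert e {p, q}) (z := w) hwg (hH.trans hE7g)
      hsH (by rw [hHfl w hwE hwH, hH3]), h3]
  have hxyw4 := hflat x y hxH hyH hYxy
  have hyzw4 := hflat y z hyH hzH hYyz
  have hxzw4 := hflat x z hxH hzH hYxz
  -- the `e`-complements have rank `≤ 4`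
  have hle_e : ∀ p : α, rk N (insert e {p, w, w'}) ≤ 4 := by
    intro p
    have h1 := rk_le_card' (M := N) (insert e ({p, w, w'} : Finset α))
    have h2 := hcard4 e p w w'
    omega
  -- `ρ(insert f {p, z}) ∈ {2, 3}`
  have hfpz : ∀ p : α, p ∈ gr N → p ∈ ((((gr N).erase b).erase b').erase f).erase e → rk N {p, z} = 2 →
      2 ≤ rk N (insert f {p, z}) ∧ rk N (insert f {p, z}) ≤ 3 := by
    intro p hpg hpX hpz
    have h1 := rk_insert_le_add_one (N := N) hf (hsub2 p z hpg hzg)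
    have h2 : rk N ({f, p} : Finset α) ≤ rk N (insert f ({p, z} : Finset α)) :=
      rk_mono' (pair_subset_insert_pair f p z)
    rw [hf1 p hpX] at h2
    omega
  constructor
  · -- PART 1: `z` is off the line `ef`
    by_contra hne
    have hefz2 : rk N ({e, f, z} : Finset α) = 2 := by
      have h1 : rk N ({e, z} : Finset α) ≤ rk N ({e, f, z} : Finset α) := rk_mono' (pair_et_subset_eft e f z)
      have h2 := rk_le_card' (M := N) ({e, f, z} : Finset α)
      have h3 := hcard3 e f z
      rw [he1 z hz] at h1
      omega
    -- `f ∈ cl{e, z}` forces `ρ({z, w, w′} + e) = 4`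
    have hB1 : rk N (insert e ({z, w, w'} : Finset α)) = 4 := by
      have hfez : rk N (insert f ({e, z} : Finset α)) = rk N ({e, z} : Finset α) := by
        rw [insert_pair_eq_mid, hefz2, he1 z hz]
      have h1 := rk_insert_eq_of_rk_insert_eq_subset' (N := N) (S := ({e, z} : Finset α))
        (S' := insert e ({z, w, w'} : Finset α)) (w := f) (pair_subset_insert_triple e z w w') hfez
      have h2 : rk N (insert f ({z, w, w'} : Finset α)) ≤ rk N (insert f (insert e ({z, w, w'} : Finset α))) :=
        rk_mono' (insert_subset_insert _ (subset_insert _ _))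
      have h3 := hle_e z
      rw [hYcxy] at h2
      omega
    -- R0 fails for `{x, y}` through `ρ({x, y} + f) = 2`
    have hfxy : rk N (insert f ({x, y} : Finset α)) = 2 := by
      have h1 := rk_insert_le_add_one (N := N) hf (hsub2 x y hxg hyg)
      have h2 : rk N ({x, y} : Finset α) ≤ rk N (insert f ({x, y} : Finset α)) := rk_mono' (subset_insert _ _)
      have h3 : ¬ rk N (insert f ({x, y} : Finset α)) = 3 := fun h' => hR0xy ⟨h', hB1⟩
      omega
    -- `e ∈ cl{f, z}`
    have hefz' : rk N (insert e ({f, z} : Finset α)) = rk N ({f, z} : Finset α) := by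
      rw [insert_pair_eq_first, hefz2, hf1 z hz]
    -- the other two demands have `ρ(π′ + f) = 3`: a collinear `{p, z, f}` would put `e ∈ cl{x, y}`
    have hline : ∀ p q : α, p ∈ gr N → p ∈ ((((gr N).erase b).erase b').erase f).erase e →
        rk N {p, z} = 2 → insert f ({p, q} : Finset α) = insert f {x, y} → rk N (insert f {p, z}) = 3 := by
      intro p q hpg hpX hpz hpq
      by_contra hne'
      have h2 : rk N (insert f ({p, z} : Finset α)) = 2 := by
        have := hfpz p hpg hpX hpz; omega
      have hz' : rk N (insert z ({f, p} : Finset α)) = rk N ({f, p} : Finset α) := by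
        rw [insert_pair_eq_last', h2, hf1 p hpX]
      have h3 := rk_insert_eq_of_rk_insert_eq_subset' (N := N) (S := ({f, p} : Finset α))
        (S' := insert f ({p, q} : Finset α)) (w := z) (pair_subset_insert_pair f p q) hz'
      rw [hpq] at h3
      have h4 := rk_insert_eq_of_rk_insert_eq_subset' (N := N) (S := ({f, z} : Finset α))
        (S' := insert z (insert f ({x, y} : Finset α))) (w := e) (pair_subset_insert_insert_pair f z x y) hefz'
      have h5 : rk N (insert e ({x, y} : Finset α)) ≤ rk N (insert e (insert z (insert f ({x, y} : Finset α)))) :=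
        rk_mono' (insert_subset_insert _ ((subset_insert _ _).trans (subset_insert _ _)))
      rw [hYxy, h4, h3, hfxy] at h5
      omega
    have hxzf := hline x y hxg hx hxz2 rfl
    have hyzf := hline y x hyg hy hyz2 (by rw [pair_comm' y x])
    have hey : rk N (insert e ({y, w, w'} : Finset α)) ≤ 3 := by
      have h1 : ¬ rk N (insert e ({y, w, w'} : Finset α)) = 4 := fun h' => hR0xz ⟨hxzf, h'⟩
      have h2 := hle_e y
      omega
    have hex : rk N (insert e ({x, w, w'} : Finset α)) ≤ 3 := by
      have h1 : ¬ rk N (insert e ({x, w, w'} : Finset α)) = 4 := fun h' => hR0yz ⟨hyzf, h'⟩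
      have h2 := hle_e x
      omega
    exact not_e_in_cl_W hxyw4 hW2 hex hey hB1
  · -- PART 2: `X − z` is not a plane
    by_contra hne
    have hP3 : rk N ({x, y, w, w'} : Finset α) ≤ 3 := by
      have h1 := rk_le_card' (M := N) ({x, y, w, w'} : Finset α)
      have h2 := hcard4 x y w w'
      omega
    -- (i) `ρ({x, y} + f) = 3`
    have hxyf : rk N (insert f ({x, y} : Finset α)) = 3 := by
      by_contra hne'
      have h2 : rk N (insert f ({x, y} : Finset α)) = 2 := by
        have h1 := rk_insert_le_add_one (N := N) hf (hsub2 x y hxg hyg)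
        have h2 : rk N ({x, y} : Finset α) ≤ rk N (insert f ({x, y} : Finset α)) := rk_mono' (subset_insert _ _)
        omega
      have hf' : rk N (insert f ({x, y} : Finset α)) = rk N ({x, y} : Finset α) := by rw [h2, hxy2]
      have h3 := rk_insert_eq_of_rk_insert_eq_subset' (N := N) (S := ({x, y} : Finset α))
        (S' := ({x, y, w, w'} : Finset α)) (w := f) (pair_subset_quad x y w w') hf'
      have h4 : rk N (insert f ({x, w, w'} : Finset α)) ≤ rk N (insert f ({x, y, w, w'} : Finset α)) :=
        rk_mono' (insert_subset_insert _ (triple_subset_quad_skip x y w w'))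
      rw [hYcyz, h3] at h4
      omega
    -- (ii) `ρ({z, w, w′} + e) ≤ 3`
    have hez : rk N (insert e ({z, w, w'} : Finset α)) ≤ 3 := by
      have h1 : ¬ rk N (insert e ({z, w, w'} : Finset α)) = 4 := fun h' => hR0xy ⟨hxyf, h'⟩
      have h2 := hle_e z
      omega
    -- (iii) not both `{x, z, f}` and `{y, z, f}` are collinear
    have hnot : ¬ (rk N (insert f ({x, z} : Finset α)) = 2 ∧ rk N (insert f ({y, z} : Finset α)) = 2) := by
      rintro ⟨h1, h2⟩
      have hx' : rk N (insert x ({f, z} : Finset α)) = rk N ({f, z} : Finset α) := by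
        rw [insert_pair_comm3, h1, hf1 z hz]
      have hy' : rk N (insert y ({f, z} : Finset α)) = rk N ({f, z} : Finset α) := by
        rw [insert_pair_comm3, h2, hf1 z hz]
      have h3 := rk_insert_eq_of_rk_insert_eq_subset' (N := N) (S := ({f, z} : Finset α))
        (S' := insert x ({f, z} : Finset α)) (w := y) (subset_insert _ _) hy'
      have h4 : rk N (insert f ({x, y} : Finset α)) ≤ rk N (insert y (insert x ({f, z} : Finset α))) :=
        rk_mono' (insert_pair_subset_insert_insert' f x y z)
      rw [hxyf, h3, hx', hf1 z hz] at h4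
      omega
    -- (iv) one of the other demands has `ρ(π′ + f) = 3`, so its `e`-complement is a plane through `e`
    by_cases hxzf : rk N (insert f ({x, z} : Finset α)) = 3
    · have hey : rk N (insert e ({y, w, w'} : Finset α)) ≤ 3 := by
        have h1 : ¬ rk N (insert e ({y, w, w'} : Finset α)) = 4 := fun h' => hR0xz ⟨hxzf, h'⟩
        have h2 := hle_e y
        omega
      exact not_plane_of_two_e_planes (N := N) (p := y) (q := x) (z := z) (w := w) (w' := w')
        (by rw [pair_comm' y x]; exact hxyw4) hyzw4 (by rw [quad_swap12]; exact hP3) hW2 hey hez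
    · have hxzf2 : rk N (insert f ({x, z} : Finset α)) = 2 := by
        have := hfpz x hxg hx hxz2; omega
      have hyzf : rk N (insert f ({y, z} : Finset α)) = 3 := by
        have := hfpz y hyg hy hyz2
        have h' : ¬ rk N (insert f ({y, z} : Finset α)) = 2 := fun h' => hnot ⟨hxzf2, h'⟩
        omega
      have hex : rk N (insert e ({x, w, w'} : Finset α)) ≤ 3 := by
        have h1 : ¬ rk N (insert e ({x, w, w'} : Finset α)) = 4 := fun h' => hR0yz ⟨hyzf, h'⟩
        have h2 := hle_e x
        omega
      exact not_plane_of_two_e_planes (N := N) (p := x) (q := y) (z := z) (w := w) (w' := w') hxyw4 hxzw4 hP3 hW2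
        hex hez

end StarSharpD0X

end PercRepro.Cogirth
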